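import Literature.MathematicalPhysics.QuantumFieldTheory.Balaban1983to89.B9Eq323KatoDomination

/-!
# `Balaban1983to89.B9Eq342SupNormBootstrap` — T. Bałaban, *Propagators for lattice gauge theories in a background field*, Commun. Math. Phys. **99** (1985)
# 389–434 [Balaban1985BackgroundPropagators] Thm 3.1 (3.42) p. 397 (first entry: the SUP-NORM bound of `G′(U)λ` on a block for `λ` supported in a block) with
# (3.24)–(3.25) p. 394 (`Δ′_a(U) = Δ^η_U + Q′*(U)aQ′(U)`, `G′ = (Δ′_a)⁻¹`) and (3.39) p. 397 (sup norms): **THE SUP-NORM BOUND OF A GREEN's FUNCTION FROM ITS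
# ENERGY BOUND, BY KATO DOMINATION USED TWICE — for `(L + P)u = f` with `L` a covariant graph Laplacian with contractive transporters (Kato form) and the
# non-Kato part entering only through a pointwise bound `‖(Pu)(x)‖ ≤ Pq`: `‖u‖_∞ ≤ 2(F + Pq)∕m + m²·C₃·‖u‖_{L²(c)}` for every `m > 0`, where `C₃` is the ONE scalar
# letter `‖(L₀ + m)⁻²‖_{L²(c)→L^∞}` of the FLAT weighted graph Laplacian** — stone (A) of the NE9 owner's SUP-NORM PROGRAMME (plan v10): with the chain's energy
# bound `‖G′_k(U)‖ ≤ 4∕γ`, the averaging letter `‖(Q′*Q′v)(x)‖ ≤ p₂‖v‖_{L²}` and the free letter `C₃` (d = 4, DFT) it yields the VALUE row of (3.42) at the top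
# level, level-free and volume-free

statement-level skeleton of published theorems with citation tags; proofs where landed; nothing here is a claim about the Yang–Mills mass gap

CITATION HEADER (lean-in-tree rule).  Audit cell `pub-balaban`, sub-cell `t4`, BINDER row NE9; filed by the row OWNER lineage `b2b-balaban-t4-ne9-p1` (gen 89,
plan v10 «the sup-norm programme», stone (A); imports the lineage's stone (K)+(MP) `B9Eq323KatoDomination` ONLY).  Sources READ first-hand in the held text
layer [Balaban1985BackgroundPropagators] (`paper:balaban1985-cmp99-background-propagators`, journal page = PDF page + 388): p. 394 (3.24) *«Δ′_a(U) = Δ^η_U +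
Q′*(U)aQ′(U)»*, (3.25) *«G′ = G′(U) = (Δ′_a)⁻¹»*; p. 397 (3.39) *«Thus we have the supremum norms |λ| = max sup|λ_μ(x)|, …»*; p. 397 Thm 3.1 *«There exist
positive constants M₁, δ₀, a₀, B₀ dependent on d and L only … such that for M ≥ M₁ and for an arbitrary configuration U satisfying the regularity condition (3.35)
with Mα₀ ≤ a₀, the operator G′(U) (a = 1) satisfies the inequalities [(3.42): |(G′(U)λ)(x)|, … ≤ B₀{(L^jη)², L^jη, L^jη, 1}·… for x ∈ Δ(y), y ∈ Λ_j, supp λ ⊂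
Δ(y′)]»*; p. 398 *«We will prove the above theorem by constructing a random walk representation …»* — NOTHING of that proof is reproduced.  [DodziukMathai2006]
(J. Dodziuk, V. Mathai, Contemp. Math. 398 (2006) §1, held `paper:arxiv-math_0312450`) Lemma 1.1 (positivity of `(Δ + λ)⁻¹`), Lemma 1.2 (Kato), Thm 1.5
(domination) are the inputs BY NAME through `B9Eq323KatoDomination`.

WHY THIS FILE (cell context; owner DIAGNOSIS D-ne9p1-g89-1).  A level-free (117) for the chain's k-level letters is a BLOCK SUP→SUP bound of (3.42)'s shape
(the space (115) is a weighted sup norm); the chain holds the letters of print's operators in the ENERGY currency only (`L²` bounds level-free on the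
diagonal: `B9Eq349ConjugatedGreenLetters.norm_Gk_le` `‖G′_k(U)‖ ≤ 4∕γ`, and their `L²` block decay).  THIS file is the abstract bridge ENERGY → SUP for
operators `L + P` whose principal part `L` is of Kato form: the covariant site Laplacian (3.23) is (`B9Eq323KatoDomination.equiv_covLaplaceSiteK_eq_sum`), the
averaging penalty `P = a′Q′*Q′` of (3.24) is not, and enters through `Pq` only.  The one analytic input left DISPLAYED is the flat scalar letter (FS)
`C₃ = ‖(L₀ + m)⁻²‖_{L²(c)→L^∞}` (finite and lattice-uniform in d = 4 for the free Laplacian with unit mass — the UV-convergence of `∫d⁴p∕(p² + m)⁴`; to be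
filed by the programme), stated on SOLUTIONS of the scalar resolvent equation so that no operator is defined here.

WHAT IS PROVED (sorry-free; 0 `def`; [folklore] potential theory on a finite weighted graph, the letters (3.39)∕(3.42) of print as the target shape).  Data as in
`B9Eq323KatoDomination` §1–§2 (finite `ι`, `J`, `nbr`, weights `0 ≤ w`, contractions `T x j` of an inner-product fibre `V` over `RCLike 𝕜`),
a weight `c : ι → ℝ` for the `L²` size `√(Σ_y c y·‖u y‖²)` (print's `η^d`, (3.11)), `0 < m`; `(L u)(x) = Σ_j (w x j : 𝕜)•(u x − T x j (u (nbr x j)))`,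
`(L₀φ)(x) = Σ_j w x j·(φ x − φ (nbr x j))` WRITTEN OUT.
* §1 scalar resolvent algebra: **`scalar_resolvent_mono`** (`(L₀+m)φ_a = ψ_a`, `(L₀+m)φ_b = ψ_b`, `ψ_a ≤ ψ_b` ⟹ `φ_a ≤ φ_b`), `scalar_resolvent_add_smul`
  (solutions combine linearly), **`scalar_le_mul_of_supersolution`** (the WEIGHTED maximum principle: `λW ≤ (L₀+m)W`, `(L₀+m)φ = g ≤ sλW` ⟹ `φ ≤ sW` — the
  Agmon-weight row-sum bound that the decay storey (D) uses in place of `scalar_le_of_resolvent`).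
* §2 **`norm_le_of_kato_bootstrap`** — THE BOOTSTRAP: if `(L u)(x) = f(x) − q(x)` for all `x` (i.e. `(L + P)u = f` with `q = Pu`), `‖f(x)‖ ≤ F`, `‖q(x)‖ ≤ Pq`, and
  the scalar letter (FS) `∀ ψ ≥ 0, (L₀+m)φ₁ = ψ, (L₀+m)φ₂ = φ₁ ⟹ φ₂(x) ≤ C₃·√(Σ_y c y ψ(y)²)` holds, then for every site
  `‖u(x)‖ ≤ 2(F + Pq)∕m + m²·C₃·√(Σ_y c y‖u(y)‖²)`.  Proof: `(L + m)u = f − q + mu`; DOMINATION (`norm_le_scalar_of_resolvent`) by `φ₁ + mφ_u` where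
  `(L₀+m)φ₁ = ‖f‖ + ‖q‖`, `(L₀+m)φ_u = ‖u‖`; `φ₁ ≤ (F+Pq)∕m` (maximum principle); MONOTONICITY `φ_u = (L₀+m)⁻¹‖u‖ ≤ (L₀+m)⁻¹(φ₁ + mφ_u) = χ₁ + mχ_u` with
  `χ₁ ≤ (F+Pq)∕m²` (maximum principle again) and `χ_u = (L₀+m)⁻²‖u‖ ≤ C₃‖u‖_{L²(c)}` (the letter).
* §3 **`norm_le_of_kato_bootstrap_energy`** — with the ENERGY letter `√(Σ c‖u‖²) ≤ C_E·√(Σ c‖f‖²)`, the penalty letter `Pq ≤ p₂·√(Σ c‖u‖²)` and a support of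
  `L²(c)`-mass `μ` for `f` (`√(Σ c‖f‖²) ≤ √μ·F`): `‖u(x)‖ ≤ (2∕m + (2p₂∕m + m²C₃)·C_E·√μ)·F` — the VALUE row of (3.42) at the top level in the abstract, its
  `B₀` CLOSED-FORM in `(m, p₂, C₃, C_E, μ)`, each letter level-free in the programme's instance (`C_E = 4∕γ`, `μ = c₁` for a unit block, `p₂ = a′∕√c₁`).
HONEST SCOPE.  Abstract potential theory; the letters (FS), (E), (P) are HYPOTHESES here (the chain supplies (E); (P) is one line for block averaging; (FS) is the
programme's one classical free-lattice input, NOT in the tree today); no decay in `d(y, y′)` (the block-decay upgrade replaces the global `L²` size by the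
chain's `L²` block decay inside the second domination step — next file); no ∇-row; no window is used or needed at this level.  NOT summit progress (cell
pub-balaban: NE9 NOT PRINTED ∕ NOT PROVED; «NE9 ⇐ the named binders»; row WALLED ON A MODEL (O-NE9-1; #5 UNRULED); spine PROVED 0∕9; rung (B)+1 finite T⁴ — NOT
infinite volume, NOT mass gap, NOT BetaPertH, NOT Clay).  HONEST DEPENDENCY (cell line): continuum YM on T⁴ ⇐ BetaPertH ∧ nine spine estimates (0/9 proved);
BetaPertH ⇐ (D1) ∧ (D4) ∧ CAP+tail; G-an2-4 gates asym, D1 and NE2/3/4.  NEW file importing `B9Eq323KatoDomination` only; nothing modified.  Net new unproved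
facts: 0.
-/

noncomputable section

open scoped InnerProductSpace ComplexConjugate BigOperators

namespace Literature.MathematicalPhysics.QuantumFieldTheory.Balaban1983to89.B9Eq342SupNormBootstrap

open B9Eq323KatoDomination (scalar_nonneg_of_resolvent scalar_le_of_resolvent norm_le_scalar_of_resolvent exists_scalar_resolvent)

variable {𝕜 : Type*} [RCLike 𝕜] {V : Type*} [NormedAddCommGroup V] [InnerProductSpace 𝕜 V]
  {ι J : Type*} [Fintype J]

/-! ## §1 The scalar resolvent `(L₀ + m)⁻¹` on a finite weighted graph: monotone and linear (stated on solutions) -/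

/-- Solutions of the scalar resolvent equation combine linearly: `(L₀+m)φ_a = ψ_a`, `(L₀+m)φ_b = ψ_b` ⟹ `(L₀+m)(φ_a + t·φ_b) = ψ_a + t·ψ_b`.
[cite: DodziukMathai2006, Lemma 1.1 §1] -/
theorem scalar_resolvent_add_smul (nbr : ι → J → ι) (w : ι → J → ℝ) (m t : ℝ) {φa φb ψa ψb : ι → ℝ}
    (ha : ∀ x, ∑ j, w x j * (φa x - φa (nbr x j)) + m * φa x = ψa x) (hb : ∀ x, ∑ j, w x j * (φb x - φb (nbr x j)) + m * φb x = ψb x)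
    (x : ι) : ∑ j, w x j * ((φa x + t * φb x) - (φa (nbr x j) + t * φb (nbr x j))) + m * (φa x + t * φb x) = ψa x + t * ψb x := by
  rw [← ha x, ← hb x]
  have h : ∑ j, w x j * ((φa x + t * φb x) - (φa (nbr x j) + t * φb (nbr x j))) =
      ∑ j, w x j * (φa x - φa (nbr x j)) + t * ∑ j, w x j * (φb x - φb (nbr x j)) := by
    rw [Finset.mul_sum, ← Finset.sum_add_distrib]
    exact Finset.sum_congr rfl fun j _ => by ring
  rw [h]; ring

/-- Solutions of the scalar resolvent equation subtract: `(L₀+m)(φ_b − φ_a) = ψ_b − ψ_a`. [cite: DodziukMathai2006, Lemma 1.1 §1] -/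
theorem scalar_resolvent_sub (nbr : ι → J → ι) (w : ι → J → ℝ) (m : ℝ) {φa φb ψa ψb : ι → ℝ}
    (ha : ∀ x, ∑ j, w x j * (φa x - φa (nbr x j)) + m * φa x = ψa x) (hb : ∀ x, ∑ j, w x j * (φb x - φb (nbr x j)) + m * φb x = ψb x)
    (x : ι) : ∑ j, w x j * ((φb x - φa x) - (φb (nbr x j) - φa (nbr x j))) + m * (φb x - φa x) = ψb x - ψa x := by
  have h := scalar_resolvent_add_smul nbr w m (-1) hb ha x
  simp only [neg_one_mul, ← sub_eq_add_neg] at h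
  exact h

variable [Fintype ι]

/-- **MONOTONICITY OF THE SCALAR RESOLVENT**: `(L₀+m)φ_a = ψ_a`, `(L₀+m)φ_b = ψ_b`, `ψ_a ≤ ψ_b` pointwise, `0 ≤ w`, `0 < m` ⟹ `φ_a ≤ φ_b` pointwise —
[DodziukMathai2006] Lemma 1.1 (positivity preserving) applied to the difference. [cite: DodziukMathai2006, Lemma 1.1 §1] -/
theorem scalar_resolvent_mono (nbr : ι → J → ι) (w : ι → J → ℝ) (hw : ∀ x j, 0 ≤ w x j) {m : ℝ} (hm : 0 < m) {φa φb ψa ψb : ι → ℝ}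
    (ha : ∀ x, ∑ j, w x j * (φa x - φa (nbr x j)) + m * φa x = ψa x) (hb : ∀ x, ∑ j, w x j * (φb x - φb (nbr x j)) + m * φb x = ψb x)
    (hab : ∀ x, ψa x ≤ ψb x) (x : ι) : φa x ≤ φb x :=
  sub_nonneg.1 (scalar_nonneg_of_resolvent nbr w hw hm (φ := fun y => φb y - φa y) (g := fun y => ψb y - ψa y)
    (scalar_resolvent_sub nbr w m ha hb) (fun y => sub_nonneg.2 (hab y)) x)

/-- **THE WEIGHTED MAXIMUM PRINCIPLE (comparison with a supersolution)**: if `W > 0` satisfies `λ·W ≤ (L₀+m)W` pointwise (`0 < λ`), `(L₀+m)φ = g` and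
`g ≤ s·λ·W` with `0 ≤ s`, then `φ ≤ s·W` pointwise — [DodziukMathai2006] Lemma 1.1 applied to `sW − φ`.  With `W = Π_ν cosh(a·d_ν(x₀, ·))` (a supersolution of the
flat lattice Laplacian for `a` small against the lattice scale, the Agmon weight of `B5G183FreeRowSum`) this is the exponentially weighted row-sum bound of the
scalar resolvent that storey (D) (decay in `d(y, y′)`) of the programme uses in place of `scalar_le_of_resolvent`. [cite: DodziukMathai2006, Lemma 1.1 §1] -/
theorem scalar_le_mul_of_supersolution (nbr : ι → J → ι) (w : ι → J → ℝ) (hw : ∀ x j, 0 ≤ w x j) {m : ℝ} (hm : 0 < m)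
    {W : ι → ℝ} {lam s : ℝ} (hs : 0 ≤ s) (hsup : ∀ x, lam * W x ≤ ∑ j, w x j * (W x - W (nbr x j)) + m * W x)
    {φ g : ι → ℝ} (hφ : ∀ x, ∑ j, w x j * (φ x - φ (nbr x j)) + m * φ x = g x) (hg : ∀ x, g x ≤ s * (lam * W x)) (x : ι) :
    φ x ≤ s * W x := by
  have h := scalar_nonneg_of_resolvent nbr w hw hm (φ := fun y => s * W y - φ y)
    (g := fun y => ∑ j, w y j * ((s * W y - φ y) - (s * W (nbr y j) - φ (nbr y j))) + m * (s * W y - φ y)) (fun y => rfl) (fun y => ?_) x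
  · exact sub_nonneg.1 h
  · have e : ∑ j, w y j * ((s * W y - φ y) - (s * W (nbr y j) - φ (nbr y j))) + m * (s * W y - φ y) =
        s * (∑ j, w y j * (W y - W (nbr y j)) + m * W y) - (∑ j, w y j * (φ y - φ (nbr y j)) + m * φ y) := by
      have hj : ∀ j, w y j * ((s * W y - φ y) - (s * W (nbr y j) - φ (nbr y j))) =
          s * (w y j * (W y - W (nbr y j))) - w y j * (φ y - φ (nbr y j)) := fun j => by ring
      simp only [hj, Finset.sum_sub_distrib, ← Finset.mul_sum]
      ring
    rw [e, hφ y]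
    have h1 := mul_le_mul_of_nonneg_left (hsup y) hs
    linarith [hg y]

/-! ## §2 The bootstrap: sup norm from the energy bound by Kato domination used twice -/

/-- **THE SUP-NORM BOUND OF A GREEN's FUNCTION FROM ITS ENERGY BOUND (Kato domination twice).**  Let `(L u)(x) = f(x) − q(x)` at every site, `L` the covariant
weighted graph Laplacian with contractive transporters (`q = Pu` the non-Kato part of the operator `L + P`, e.g. the averaging penalty `a′Q′*Q′u` of (3.24)), with
`‖f(x)‖ ≤ F`, `‖q(x)‖ ≤ Pq`, `0 < m`, and assume the FLAT scalar letter (FS): whenever `ψ ≥ 0`, `(L₀+m)φ₁ = ψ` and `(L₀+m)φ₂ = φ₁`, then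
`φ₂(x) ≤ C₃·√(Σ_y c(y)ψ(y)²)`.  Then at every site `‖u(x)‖ ≤ 2(F + Pq)∕m + m²·C₃·√(Σ_y c(y)‖u(y)‖²)` — the sup norm of (3.39) controlled by the sup norms of
the data and the `L²` size (3.11) of the solution, for EVERY contractive background, with no window. [cite: Balaban1985BackgroundPropagators, (3.42) p.397, (3.39) p.397, (3.24) p.394] -/
theorem norm_le_of_kato_bootstrap (nbr : ι → J → ι) (w : ι → J → ℝ) (hw : ∀ x j, 0 ≤ w x j) (T : ι → J → V →ₗ[𝕜] V)
    (hT : ∀ x j v, ‖T x j v‖ ≤ ‖v‖) (c : ι → ℝ) {m C₃ : ℝ} (hm : 0 < m)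
    (hFS : ∀ ψ φ₁ φ₂ : ι → ℝ, (∀ x, 0 ≤ ψ x) → (∀ x, ∑ j, w x j * (φ₁ x - φ₁ (nbr x j)) + m * φ₁ x = ψ x) →
      (∀ x, ∑ j, w x j * (φ₂ x - φ₂ (nbr x j)) + m * φ₂ x = φ₁ x) → ∀ x, φ₂ x ≤ C₃ * Real.sqrt (∑ y, c y * ψ y ^ 2))
    {u f q : ι → V} (hu : ∀ x, ∑ j, (w x j : 𝕜) • (u x - T x j (u (nbr x j))) = f x - q x)
    {F Pq : ℝ} (hF : ∀ x, ‖f x‖ ≤ F) (hPq : ∀ x, ‖q x‖ ≤ Pq) (x : ι) :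
    ‖u x‖ ≤ 2 * (F + Pq) / m + m ^ 2 * C₃ * Real.sqrt (∑ y, c y * ‖u y‖ ^ 2) := by
  -- the resolvent equation `(L + m)u = f − q + m u`
  have hu' : ∀ y, ∑ j, (w y j : 𝕜) • (u y - T y j (u (nbr y j))) + (m : 𝕜) • u y = f y - q y + (m : 𝕜) • u y := fun y => by rw [hu y]
  -- scalar comparison solutions: `(L₀+m)φ₁ = ‖f‖ + ‖q‖`, `(L₀+m)φᵤ = ‖u‖`, and their second-level companions
  obtain ⟨φ₁, hφ₁⟩ := exists_scalar_resolvent nbr w hw hm fun y => ‖f y‖ + ‖q y‖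
  obtain ⟨φu, hφu⟩ := exists_scalar_resolvent nbr w hw hm fun y => ‖u y‖
  obtain ⟨χ₁, hχ₁⟩ := exists_scalar_resolvent nbr w hw hm φ₁
  obtain ⟨χu, hχu⟩ := exists_scalar_resolvent nbr w hw hm φu
  -- `φ := φ₁ + m φᵤ` solves `(L₀+m)φ = ‖f‖ + ‖q‖ + m‖u‖ ≥ ‖f − q + m u‖`
  have hφ := scalar_resolvent_add_smul nbr w m m hφ₁ hφu
  -- FIRST DOMINATION: `‖u‖ ≤ φ₁ + m φᵤ`
  have hdom : ∀ y, ‖u y‖ ≤ φ₁ y + m * φu y := fun y =>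
    norm_le_scalar_of_resolvent nbr w hw T hT hm hu' hφ (fun z => by
      refine (norm_add_le _ _).trans (add_le_add (norm_sub_le _ _) ?_)
      rw [norm_smul, RCLike.norm_ofReal, abs_of_pos hm]) y
  -- maximum principle on `φ₁` and `χ₁`
  have hFPq : 0 ≤ F + Pq := by
    have := (norm_nonneg (f x)).trans (hF x); have := (norm_nonneg (q x)).trans (hPq x); linarith
  have hφ₁le : ∀ y, φ₁ y ≤ (F + Pq) / m := fun y =>
    scalar_le_of_resolvent nbr w hw hm hφ₁ (fun z => add_le_add (hF z) (hPq z)) y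
  have hχ₁le : ∀ y, χ₁ y ≤ (F + Pq) / m / m := fun y => scalar_le_of_resolvent nbr w hw hm hχ₁ hφ₁le y
  -- the letter (FS) on `χᵤ = (L₀+m)⁻²‖u‖`
  have hχule : ∀ y, χu y ≤ C₃ * Real.sqrt (∑ z, c z * ‖u z‖ ^ 2) :=
    hFS (fun z => ‖u z‖) φu χu (fun z => norm_nonneg _) hφu hχu
  -- SECOND DOMINATION (monotonicity): `φᵤ = (L₀+m)⁻¹‖u‖ ≤ (L₀+m)⁻¹(φ₁ + mφᵤ) = χ₁ + mχᵤ`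
  have hχ := scalar_resolvent_add_smul nbr w m m hχ₁ hχu
  have hφule : ∀ y, φu y ≤ χ₁ y + m * χu y := fun y => scalar_resolvent_mono nbr w hw hm hφu hχ hdom y
  -- assemble
  have h1 := hdom x
  have h2 := hφule x
  have h3 := hχ₁le x
  have h4 := hχule x
  have h5 := hφ₁le x
  have hm2 : m * χu x ≤ m * (C₃ * Real.sqrt (∑ z, c z * ‖u z‖ ^ 2)) := mul_le_mul_of_nonneg_left h4 hm.le
  have hm3 : m * φu x ≤ m * ((F + Pq) / m / m + m * (C₃ * Real.sqrt (∑ z, c z * ‖u z‖ ^ 2))) :=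
    mul_le_mul_of_nonneg_left (h2.trans (add_le_add h3 hm2)) hm.le
  have hcalc : (F + Pq) / m + m * ((F + Pq) / m / m + m * (C₃ * Real.sqrt (∑ z, c z * ‖u z‖ ^ 2))) =
      2 * (F + Pq) / m + m ^ 2 * C₃ * Real.sqrt (∑ y, c y * ‖u y‖ ^ 2) := by
    field_simp
    ring
  linarith [h1, h5, hm3, hcalc.le]

/-! ## §3 With the energy, penalty and support letters: the VALUE row of (3.42) at the top level, `B₀` closed-form -/

/-- **THE VALUE ROW OF (3.42) IN THE ABSTRACT, `B₀` CLOSED-FORM.**  In the situation of `norm_le_of_kato_bootstrap`, assume moreover the ENERGY letter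
`√(Σ c‖u‖²) ≤ C_E·√(Σ c‖f‖²)` (the chain's `‖G′_k(U)‖ ≤ 4∕γ`), the PENALTY letter `Pq ≤ p₂·√(Σ c‖u‖²)` (block averaging: `‖(a′Q′*Q′v)(x)‖ ≤ (a′∕√c₁)‖v‖_{L²}`) and
a SUPPORT letter `√(Σ c‖f‖²) ≤ √μ·F` (`f` supported in a set of `L²(c)`-mass `μ`, e.g. one block of the unit lattice: `μ = c₁`).  Then at every site
`‖u(x)‖ ≤ (2∕m + (2p₂∕m + m²C₃)·C_E·√μ)·F` — print's «|(G′(U)λ)(x)| ≤ B₀·|λ|» at `L^jη = 1` with `B₀` level-free and volume-free as soon as the five letters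
are. [cite: Balaban1985BackgroundPropagators, Thm 3.1 (3.42) p.397] -/
theorem norm_le_of_kato_bootstrap_energy (nbr : ι → J → ι) (w : ι → J → ℝ) (hw : ∀ x j, 0 ≤ w x j) (T : ι → J → V →ₗ[𝕜] V)
    (hT : ∀ x j v, ‖T x j v‖ ≤ ‖v‖) (c : ι → ℝ) {m C₃ : ℝ} (hm : 0 < m) (hC₃ : 0 ≤ C₃)
    (hFS : ∀ ψ φ₁ φ₂ : ι → ℝ, (∀ x, 0 ≤ ψ x) → (∀ x, ∑ j, w x j * (φ₁ x - φ₁ (nbr x j)) + m * φ₁ x = ψ x) →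
      (∀ x, ∑ j, w x j * (φ₂ x - φ₂ (nbr x j)) + m * φ₂ x = φ₁ x) → ∀ x, φ₂ x ≤ C₃ * Real.sqrt (∑ y, c y * ψ y ^ 2))
    {u f q : ι → V} (hu : ∀ x, ∑ j, (w x j : 𝕜) • (u x - T x j (u (nbr x j))) = f x - q x)
    {F Pq CE p₂ μ : ℝ} (hF : ∀ x, ‖f x‖ ≤ F) (hPq : ∀ x, ‖q x‖ ≤ Pq) (hp₂ : 0 ≤ p₂) (hCE : 0 ≤ CE)
    (hE : Real.sqrt (∑ y, c y * ‖u y‖ ^ 2) ≤ CE * Real.sqrt (∑ y, c y * ‖f y‖ ^ 2))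
    (hPq₂ : Pq ≤ p₂ * Real.sqrt (∑ y, c y * ‖u y‖ ^ 2)) (hsupp : Real.sqrt (∑ y, c y * ‖f y‖ ^ 2) ≤ Real.sqrt μ * F) (x : ι) :
    ‖u x‖ ≤ (2 / m + (2 * p₂ / m + m ^ 2 * C₃) * CE * Real.sqrt μ) * F := by
  have h0 := norm_le_of_kato_bootstrap nbr w hw T hT c hm hFS hu hF hPq x
  have hF0 : 0 ≤ F := (norm_nonneg (f x)).trans (hF x)
  set Nu := Real.sqrt (∑ y, c y * ‖u y‖ ^ 2) with hNu
  have hNu_le : Nu ≤ CE * (Real.sqrt μ * F) := hE.trans (mul_le_mul_of_nonneg_left hsupp hCE)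
  have hPq' : Pq ≤ p₂ * (CE * (Real.sqrt μ * F)) := hPq₂.trans (mul_le_mul_of_nonneg_left hNu_le hp₂)
  have h1 : 2 * (F + Pq) / m ≤ 2 * F / m + 2 * p₂ / m * (CE * (Real.sqrt μ * F)) := by
    have h1' : 2 / m * Pq ≤ 2 / m * (p₂ * (CE * (Real.sqrt μ * F))) := mul_le_mul_of_nonneg_left hPq' (by positivity)
    have e1 : 2 * (F + Pq) / m = 2 * F / m + 2 / m * Pq := by ring
    have e2 : 2 * p₂ / m * (CE * (Real.sqrt μ * F)) = 2 / m * (p₂ * (CE * (Real.sqrt μ * F))) := by ring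
    linarith
  have h2 : m ^ 2 * C₃ * Nu ≤ m ^ 2 * C₃ * (CE * (Real.sqrt μ * F)) := mul_le_mul_of_nonneg_left hNu_le (by positivity)
  calc ‖u x‖ ≤ 2 * (F + Pq) / m + m ^ 2 * C₃ * Nu := h0
    _ ≤ 2 * F / m + 2 * p₂ / m * (CE * (Real.sqrt μ * F)) + m ^ 2 * C₃ * (CE * (Real.sqrt μ * F)) := add_le_add h1 h2
    _ = (2 / m + (2 * p₂ / m + m ^ 2 * C₃) * CE * Real.sqrt μ) * F := by ring

end Literature.MathematicalPhysics.QuantumFieldTheory.Balaban1983to89.B9Eq342SupNormBootstrap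

end
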